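import Literature.NumberTheory.LFunctions.ConreyIwaniec2002HeckeVoronoiExp
import Literature.NumberTheory.LFunctions.ConreyIwaniec2002CircleMethodDivisorSums
import Literature.Analysis.FunctionSpaces.BesselJSqrtKernelDecayExp
import Mathlib.Analysis.SpecialFunctions.Gaussian.GaussianIntegral
import HarnessLib

/-!
# Conrey–Iwaniec (2002), Proposition 3.1 at weight one: the two continuity estimates

B. Conrey, H. Iwaniec, Acta Arith. 103 (2002), §3 Proposition 3.1 (3.11)–(3.13), §4 (4.23)
[held text `paper:arxiv-math_0111012`, p0008, p0012].

Cell `landau-siegel/ls-inputs`, sub-line `theta-voronoi`, stub V2 `HeckeVoronoiWeightOne`. The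
summation formula (3.11) holds for exponential polynomials (`voronoi_hasSum_expPoly`); to pass to a
`C²` test function `g` compactly supported in `(0,∞)` we approximate `g` by exponential
polynomials `f` with `|f-g|, |f'-g'|, |f''-g''| ≤ εe^{-2x}` (`exists_expPoly_approx`) and need
that both sides of (3.11) move by `O(ε)`. This file proves the two estimates for a difference
`D = f - g` with `‖D‖, ‖D'‖, ‖D''‖ ≤ εe^{-2x}` on `[0,∞)`:

* `dual_side_bound` — `Σ_m |b(m+1)|·|∫₀^∞ D(x)J₀((4π/c)√((m+1)x/r))dx| ≤ C₁ε`, from the Bessel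
  decay bound `|∫DJ₀(β√x)| ≤ Kβ^{-5/2}∫x^{3/4}|D''|` (tree
  `norm_integral_mul_besselJ_zero_sqrt_le_of_exp_decay`, (4.23)) and `Σ τ(m)m^{-5/4} < ∞` (tree
  `CircleMethod.summable_card_divisors_mul_rpow`);
* `main_side_bound` — `|Σ_{n≥1} a(n)e(nx_A)D(n)| ≤ C₂ε`.

No definitions. «The programme SEARCHES and TYPES; no claim about Landau–Siegel zeros until a
kernel theorem says so.»
-/

noncomputable section

open scoped Topology FourierTransform
open Filter Set MeasureTheory Complex

namespace Literature.NumberTheory.LFunctions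

namespace ConreyIwaniec2002

open Literature.Analysis.FunctionSpaces

/-! ## The dual frequencies `β_m = (4π/c)√(m/r)` -/

/-- `β_m = (4π/c)√(m/r) > 0` for `c ≥ 1`, `m ≥ 1`. [folklore] -/
private theorem beta_pos {c r m : ℕ} (hc : 1 ≤ c) (hm : 1 ≤ m) (hr : 1 ≤ r) :
    0 < 4 * Real.pi / c * Real.sqrt ((m : ℝ) / r) := by
  have hc0 : (0 : ℝ) < c := by exact_mod_cast hc
  have hm0 : (0 : ℝ) < m := by exact_mod_cast hm
  have hr0 : (0 : ℝ) < r := by exact_mod_cast hr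
  have : 0 < Real.sqrt ((m : ℝ) / r) := Real.sqrt_pos.mpr (by positivity)
  positivity

/-- `β_m^{-5/2} = (4π/c)^{-5/2}·(r^{-5/4})⁻¹·m^{-5/4}`. [folklore] -/
private theorem beta_rpow_eq {c r : ℕ} (hc : 1 ≤ c) (hr : 1 ≤ r) (m : ℕ) :
    (4 * Real.pi / c * Real.sqrt ((m : ℝ) / r)) ^ (-(5 / 2 : ℝ)) =
      (4 * Real.pi / c) ^ (-(5 / 2 : ℝ)) * ((r : ℝ) ^ (-(5 / 4 : ℝ)))⁻¹ *
        (m : ℝ) ^ (-(5 / 4 : ℝ)) := by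
  have hc0 : (0 : ℝ) < c := by exact_mod_cast hc
  have hr0 : (0 : ℝ) < r := by exact_mod_cast hr
  have hm0 : (0 : ℝ) ≤ m := Nat.cast_nonneg m
  rw [Real.mul_rpow (by positivity) (Real.sqrt_nonneg _), Real.sqrt_eq_rpow,
    ← Real.rpow_mul (by positivity), show (1 / 2 : ℝ) * (-(5 / 2 : ℝ)) = -(5 / 4 : ℝ) by norm_num,
    Real.div_rpow hm0 hr0.le]
  ring

/-! ## The dual side: `Σ_m |b(m+1)| |∫ D·k_{c,m+1}| ≤ C₁ε` -/

/-- **Continuity of the dual side of (3.11) in the weighted `C²` norm**: there is `C₁` (depending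
on `c, r, M` only) such that for every `ε` and every `D` with derivatives `D'`, `D''` everywhere,
`D''` continuous and `‖D‖, ‖D'‖, ‖D''‖ ≤ εe^{-2x}` on `[0,∞)`, the series
`Σ_m |b(m+1)|·|∫₀^∞ D(x)J₀((4π/c)√((m+1)x/r))dx|` converges and is `≤ C₁ε`
(`|b(n)| ≤ Mτ(n)`; Bessel decay (4.23) `≪ β^{-5/2}`, `β_m^{-5/2} ∝ m^{-5/4}`, and `Στ(m)m^{-5/4} < ∞`).
[cite: ConreyIwaniec2002, §4 (4.23); Proposition 3.1 (3.11)–(3.13)] -/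
theorem dual_side_bound {c r : ℕ} (hc : 1 ≤ c) (hr : 1 ≤ r) {M : ℝ} {lamB : ℕ → ℂ}
    (hB : ∀ n : ℕ, ‖lamB n‖ ≤ M * (Nat.divisors n).card) :
    ∃ C₁ : ℝ, ∀ (ε : ℝ) (D D' D'' : ℝ → ℂ), (∀ x, HasDerivAt D (D' x) x) →
      (∀ x, HasDerivAt D' (D'' x) x) → Continuous D'' →
      (∀ x, 0 ≤ x → ‖D x‖ ≤ ε * Real.exp (-(2 * x)) ∧ ‖D' x‖ ≤ ε * Real.exp (-(2 * x)) ∧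
        ‖D'' x‖ ≤ ε * Real.exp (-(2 * x))) →
      Summable (fun m : ℕ => ‖lamB (m + 1)‖ *
        ‖∫ x in Ioi (0 : ℝ), D x * ciBesselKernel (fun _ ↦ r) c (m + 1) x‖) ∧
      (∑' m : ℕ, ‖lamB (m + 1)‖ *
        ‖∫ x in Ioi (0 : ℝ), D x * ciBesselKernel (fun _ ↦ r) c (m + 1) x‖) ≤ C₁ * ε := by
  obtain ⟨K, hK0, hK⟩ := norm_integral_mul_besselJ_zero_sqrt_le_of_exp_decay
  have hM := divisorBound_nonneg hB
  -- constants
  set B₀ : ℝ := (4 * Real.pi / c) ^ (-(5 / 2 : ℝ)) * ((r : ℝ) ^ (-(5 / 4 : ℝ)))⁻¹ with hB₀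
  have hB₀0 : 0 ≤ B₀ := by positivity
  set I₀ : ℝ := ∫ x in Ioi (0 : ℝ), x ^ (3 / 4 : ℝ) * Real.exp (-(2 * x)) with hI₀
  have hI₀0 : 0 ≤ I₀ := setIntegral_nonneg measurableSet_Ioi fun x (hx : 0 < x) => by positivity
  set S₁ : ℝ := ∑' m : ℕ, (((m + 1).divisors.card : ℝ) * ((m + 1 : ℕ) : ℝ) ^ (-(5 / 4 : ℝ))) with hS₁
  have hS₁s : Summable (fun m : ℕ => ((m + 1).divisors.card : ℝ) * ((m + 1 : ℕ) : ℝ) ^ (-(5 / 4 : ℝ))) :=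
    (summable_nat_add_iff 1).mpr CircleMethod.summable_card_divisors_mul_rpow
  have hS₁0 : 0 ≤ S₁ := tsum_nonneg fun m => by positivity
  refine ⟨M * K * B₀ * I₀ * S₁, fun ε D D' D'' hD hD' hD''c hbd => ?_⟩
  have hε : 0 ≤ ε := by
    have := (hbd 0 le_rfl).1
    have h1 : Real.exp (-(2 * 0)) = 1 := by simp
    rw [h1, mul_one] at this
    exact (norm_nonneg _).trans this
  -- `∫ x^{3/4} ‖D''‖ ≤ ε I₀`
  have hI2 : IntegrableOn (fun x : ℝ => x ^ (3 / 4 : ℝ) * Real.exp (-(2 * x))) (Ioi 0) := by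
    have h := integrableOn_rpow_mul_exp_neg_mul_rpow (s := 3 / 4) (p := 1) (b := 2)
      (by norm_num) le_rfl (by norm_num)
    refine h.congr_fun (fun x _ => ?_) measurableSet_Ioi
    simp only [Real.rpow_one, neg_mul]
  have hint : (∫ x in Ioi (0 : ℝ), x ^ (3 / 4 : ℝ) * ‖D'' x‖) ≤ ε * I₀ := by
    rw [hI₀, ← integral_const_mul]
    refine setIntegral_mono_on (integrableOn_rpow_mul_norm_of_exp_decay hD''c hbd two_pos)
      (hI2.const_mul ε) measurableSet_Ioi fun x (hx : 0 < x) => ?_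
    have := (hbd x hx.le).2.2
    calc x ^ (3 / 4 : ℝ) * ‖D'' x‖ ≤ x ^ (3 / 4 : ℝ) * (ε * Real.exp (-(2 * x))) :=
          mul_le_mul_of_nonneg_left this (Real.rpow_nonneg hx.le _)
      _ = ε * (x ^ (3 / 4 : ℝ) * Real.exp (-(2 * x))) := by ring
  -- termwise bound
  have hterm : ∀ m : ℕ, ‖lamB (m + 1)‖ *
      ‖∫ x in Ioi (0 : ℝ), D x * ciBesselKernel (fun _ ↦ r) c (m + 1) x‖ ≤
      (M * K * B₀ * I₀ * ε) * (((m + 1).divisors.card : ℝ) * ((m + 1 : ℕ) : ℝ) ^ (-(5 / 4 : ℝ))) := by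
    intro m
    have hβ := beta_pos (m := m + 1) hc (by omega) hr
    have hJ := hK _ hβ D D' D'' ε 2 two_pos hD hD' hD''c
      (fun x hx => by simpa only using hbd x hx)
    simp_rw [ciBesselKernel_const_eq]
    have h1 : ‖∫ x in Ioi (0 : ℝ), D x *
        ((besselJ 0 ((4 * Real.pi / c * Real.sqrt (((m + 1 : ℕ) : ℝ) / r)) * Real.sqrt x) : ℝ) : ℂ)‖ ≤
        K * B₀ * ((m + 1 : ℕ) : ℝ) ^ (-(5 / 4 : ℝ)) * (ε * I₀) := by
      refine hJ.trans ?_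
      rw [beta_rpow_eq hc hr (m + 1), hB₀]
      have : 0 ≤ K * ((4 * Real.pi / c) ^ (-(5 / 2 : ℝ)) * ((r : ℝ) ^ (-(5 / 4 : ℝ)))⁻¹ *
          ((m + 1 : ℕ) : ℝ) ^ (-(5 / 4 : ℝ))) := by positivity
      calc K * ((4 * Real.pi / c) ^ (-(5 / 2 : ℝ)) * ((r : ℝ) ^ (-(5 / 4 : ℝ)))⁻¹ *
            ((m + 1 : ℕ) : ℝ) ^ (-(5 / 4 : ℝ))) * ∫ x in Ioi (0 : ℝ), x ^ (3 / 4 : ℝ) * ‖D'' x‖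
          ≤ K * ((4 * Real.pi / c) ^ (-(5 / 2 : ℝ)) * ((r : ℝ) ^ (-(5 / 4 : ℝ)))⁻¹ *
            ((m + 1 : ℕ) : ℝ) ^ (-(5 / 4 : ℝ))) * (ε * I₀) := mul_le_mul_of_nonneg_left hint this
        _ = _ := by ring
    have h2 := hB (m + 1)
    have h3 : 0 ≤ ‖∫ x in Ioi (0 : ℝ), D x *
        ((besselJ 0 ((4 * Real.pi / c * Real.sqrt (((m + 1 : ℕ) : ℝ) / r)) * Real.sqrt x) : ℝ) : ℂ)‖ :=
      norm_nonneg _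
    have h4 : 0 ≤ M * ((m + 1).divisors.card : ℝ) := by positivity
    calc ‖lamB (m + 1)‖ * ‖∫ x in Ioi (0 : ℝ), D x *
          ((besselJ 0 ((4 * Real.pi / c * Real.sqrt (((m + 1 : ℕ) : ℝ) / r)) * Real.sqrt x) : ℝ) : ℂ)‖
        ≤ (M * ((m + 1).divisors.card : ℝ)) * (K * B₀ * ((m + 1 : ℕ) : ℝ) ^ (-(5 / 4 : ℝ)) * (ε * I₀)) :=
          mul_le_mul h2 h1 h3 h4
      _ = _ := by ring
  have hmaj : Summable (fun m : ℕ => (M * K * B₀ * I₀ * ε) *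
      (((m + 1).divisors.card : ℝ) * ((m + 1 : ℕ) : ℝ) ^ (-(5 / 4 : ℝ)))) := hS₁s.mul_left _
  have hsum : Summable (fun m : ℕ => ‖lamB (m + 1)‖ *
      ‖∫ x in Ioi (0 : ℝ), D x * ciBesselKernel (fun _ ↦ r) c (m + 1) x‖) :=
    Summable.of_nonneg_of_le (fun m => by positivity) hterm hmaj
  refine ⟨hsum, ?_⟩
  calc (∑' m : ℕ, ‖lamB (m + 1)‖ * ‖∫ x in Ioi (0 : ℝ), D x * ciBesselKernel (fun _ ↦ r) c (m + 1) x‖)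
      ≤ ∑' m : ℕ, (M * K * B₀ * I₀ * ε) *
          (((m + 1).divisors.card : ℝ) * ((m + 1 : ℕ) : ℝ) ^ (-(5 / 4 : ℝ))) :=
        Summable.tsum_le_tsum hterm hsum hmaj
    _ = M * K * B₀ * I₀ * S₁ * ε := by rw [tsum_mul_left, hS₁]; ring

/-! ## The main side: `|Σ a(n)e(nx_A)D(n)| ≤ C₂ε`, `∫|D| ≤ ε/2` -/

/-- **Continuity of the main side of (3.11) in the weighted sup norm**: with `|a(n)| ≤ Mτ(n)`
there is `C₂` such that for every `ε` and every `D` with `‖D(x)‖ ≤ εe^{-2x}` on `[0,∞)`: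
the series `Σ_{n≥1} a(n)e(nx_A)D(n)` converges absolutely and has norm `≤ C₂ε`.
[cite: ConreyIwaniec2002, Proposition 3.1 (3.11)] -/
theorem main_side_bound {M : ℝ} {lamA : ℕ → ℂ}
    (hA : ∀ n : ℕ, ‖lamA n‖ ≤ M * (Nat.divisors n).card) (xA : ℝ) :
    ∃ C₂ : ℝ, ∀ (ε : ℝ) (D : ℝ → ℂ), (∀ x, 0 ≤ x → ‖D x‖ ≤ ε * Real.exp (-(2 * x))) →
      Summable (fun n : ℕ => lamA (n + 1) * ((𝐞 (((n : ℝ) + 1) * xA) : Circle) : ℂ) * D ((n : ℝ) + 1)) ∧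
      ‖∑' n : ℕ, lamA (n + 1) * ((𝐞 (((n : ℝ) + 1) * xA) : Circle) : ℂ) * D ((n : ℝ) + 1)‖ ≤ C₂ * ε := by
  have hM := divisorBound_nonneg hA
  -- `S₀ = Σ (n+1) e^{-2(n+1)}`
  have hS₀s : Summable (fun n : ℕ => (((n + 1 : ℕ) : ℝ)) ^ 1 * Real.exp (-2 * ((n + 1 : ℕ) : ℝ))) :=
    (summable_nat_add_iff 1).mpr (Real.summable_pow_mul_exp_neg_nat_mul 1 two_pos)
  set S₀ : ℝ := ∑' n : ℕ, (((n + 1 : ℕ) : ℝ)) ^ 1 * Real.exp (-2 * ((n + 1 : ℕ) : ℝ)) with hS₀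
  have hS₀0 : 0 ≤ S₀ := tsum_nonneg fun n => by positivity
  refine ⟨M * S₀, fun ε D hD => ?_⟩
  have hε : 0 ≤ ε := by
    have := hD 0 le_rfl
    have h1 : Real.exp (-(2 * 0)) = 1 := by simp
    rw [h1, mul_one] at this
    exact (norm_nonneg _).trans this
  have hterm : ∀ n : ℕ, ‖lamA (n + 1) * ((𝐞 (((n : ℝ) + 1) * xA) : Circle) : ℂ) * D ((n : ℝ) + 1)‖ ≤
      (M * ε) * ((((n + 1 : ℕ) : ℝ)) ^ 1 * Real.exp (-2 * ((n + 1 : ℕ) : ℝ))) := by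
    intro n
    rw [norm_mul, norm_mul, Circle.norm_coe, mul_one]
    have h1 : ‖lamA (n + 1)‖ ≤ M * ((n : ℝ) + 1) := by
      have hτ : (((n + 1).divisors.card : ℕ) : ℝ) ≤ ((n + 1 : ℕ) : ℝ) := by
        exact_mod_cast Nat.card_divisors_le_self (n + 1)
      have := (hA (n + 1)).trans (mul_le_mul_of_nonneg_left hτ hM)
      push_cast at this
      exact this
    have h2 := hD ((n : ℝ) + 1) (by positivity)
    push_cast
    rw [pow_one, show -2 * ((n : ℝ) + 1) = -(2 * ((n : ℝ) + 1)) by ring]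
    calc ‖lamA (n + 1)‖ * ‖D ((n : ℝ) + 1)‖
        ≤ (M * ((n : ℝ) + 1)) * (ε * Real.exp (-(2 * ((n : ℝ) + 1)))) :=
          mul_le_mul h1 h2 (norm_nonneg _) (by positivity)
      _ = _ := by ring
  have hmaj : Summable (fun n : ℕ => (M * ε) * ((((n + 1 : ℕ) : ℝ)) ^ 1 *
      Real.exp (-2 * ((n + 1 : ℕ) : ℝ)))) := hS₀s.mul_left _
  have hsum := Summable.of_norm_bounded hmaj hterm
  refine ⟨hsum, ?_⟩
  calc ‖∑' n : ℕ, lamA (n + 1) * ((𝐞 (((n : ℝ) + 1) * xA) : Circle) : ℂ) * D ((n : ℝ) + 1)‖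
      ≤ ∑' n : ℕ, (M * ε) * ((((n + 1 : ℕ) : ℝ)) ^ 1 * Real.exp (-2 * ((n + 1 : ℕ) : ℝ))) :=
        tsum_of_norm_bounded hmaj.hasSum hterm
    _ = M * S₀ * ε := by rw [tsum_mul_left, hS₀]; ring

end ConreyIwaniec2002

end Literature.NumberTheory.LFunctions

end
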